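/-
Copyright (c) 2026 the pub-hodgecm-mathlib formalisation cell (harness21).  Prover seat hodgecm-mathlib-R90-IF-p02 (g2), programme R90-TF, section S9 «InnerForm-13.3.6 (c)»,
re-deal (J7-c) tail «p07's (MN-cm) residual `hex` — transfer existence on `𝓕₀`» (R90-IF-plan (g2), R90 bus 2026-09-04T23:11:37Z).
-/
import Summits.HodgeConjecture.HodgeConjecture.Theorems.R90S9DatumOfRecordCM   -- ★ p862941 (p05): `Smooth_cm`, `Transfer_cm`, `TransferH_cm`; cone ★ p862626 `isKcBiInv_tensOfPair`, ★ p862596 `tensOfPair`, ★ `F0P3SemilocalTestFunctionsOfRecord.tens₀_smooth`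
import HarnessLib

/-!
# R90-TF · S9 «InnerForm-13.3.6 (c)» — the `hex` binder «SMOOTH TRANSFER EXISTS ON THE TEST PAIRS `𝓕₀`» AT THE RECORD'S PINS, from the T1 kit laws
# «Smooth ⟺ test pure tensor» (pin (iv)) and «transfer existence» (T1g) taken in GENERIC shape (Rogawski 1990 §14.2 p. 233 (14.2.1), §14.3 p. 234, §4.9 Prop. 4.9.1 p. 55)

Cell `hodgecm-mathlib`, crux H413 (`stmt-HodgeConjecture-24833`, lane `--supports … --as helper`), route of record `HCCMUnconditional` (no route verbs; count-neutral).
Programme R90-TF (HUMAN RULING «R90-TF SLAB — MAX PUSH»; brief `director/R90-BRIEF.v2.md` 1f40d54518340a35), section S9 = InnerForm-13.3.6 (c) (base `R90-IF`); seat R90-IF-p02 (g2);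
re-deal (J7-c) of R90-IF-plan (g2) 23:11:37Z, tail clause «then p07's (MN-cm) residual `hex` (transfer existence on `𝓕₀(e)`, shared with (CMP)) ★-census».  THEOREMS ONLY (no `def`,
no instance, no notation, no named-fact hypothesis, no `sorry`); imports ★ `Theorems` only (FILE B ED. 4 imports THIS file).
HONEST LABEL: HC_CM is proved only modulo the 7 printed citations (2 remaining named inputs: hLiu418 = stmt-HodgeConjecture-24832, h413 = stmt-HodgeConjecture-24833) — until
rung 0 closes.  This file proves NOTHING printed about transfer: it is the 6-line DICTIONARY between the kit's two transfer laws, quoted GENERICALLY over abstract predicates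
`Smooth ∕ Transfer ∕ TransferH : TestGp L H → … → Prop` (at B: `𝔨.Smooth ∕ 𝔨.Transfer ∕ 𝔨.TransferH`, the laws = pin (iv) of `hpin : 𝔨.IsPinned …` and `htE : 𝔨.TransferExistence`, both
v5-telescope binders — so the sub-socket is closed IN B with 0 `sorry` and NO new residual), and the `hex` binder of ★ p07 (MN-cm) `hmn_gammaSph_ofLevelPins` (`Theorems/R90S9HmnAtLevelDatum`
:233 `hex : ∀ f′, 𝓣 f′ → ∃ f fH, Transfer f′ f ∧ TransferH f′ fH`) ∕ ★ p03 (CMP-L2) `hcoeffMem_binder_gammaSph_recordSCD_ofLevels'` (:196 `hex`, `e := 𝟙_{K_v}`) at the pay line's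
instantiation `𝓣 := 𝓕₀` (the restricted pure-tensor pairs with UNIT unramified factors — the class of ★ (d2) `isCountablyLinIndepOn_gammaSph_tr'` at `e_v = 𝟙_{K_v}`, = the guard of
★ `Smooth_cm` :144–:145 BYTE FOR BYTE), `Transfer := Transfer₀ = fun p f => Smooth_cm p ∧ Transfer_cm p f` (SEAM 8), `TransferH := TransferH_cm` (TG-5).

## The print [Rogawski1990, §14.2 p. 233 (14.2.1); §14.3 p. 234; §4.9 Prop. 4.9.1 p. 55]
«Let `f′ = ∏ f′_v` be a smooth compactly supported function on `G′(𝔸)` … there exists `f = ∏ f_v` on `G(𝔸)` such that `Φ(γ, f) = Φ(γ′, f′)` … (14.2.1)» (§14.2), and `f′ ↦ f′^H`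
(§14.3, Prop. 4.9.1 at every place): smooth transfer EXISTS for every smooth pure tensor.  A test pair `p = (φ, (f_v)_v) ∈ 𝓕₀` realises to the pure tensor
`tensOfPair p = φ ⊗ ⊗_v f_v ∈ C_c(G′(𝔸))` (★ p862596), which IS a test pure tensor (★ `tens₀_smooth`), hence `Smooth` by pin (iv), hence has transfers `f`, `f^H` by T1g;
the guard `IsKcBiInv (tensOfPair p)` of `Transfer_cm` holds for every `p` (★ p862626 `isKcBiInv_tensOfPair`).

## Contents (namespace `Summit.HodgeConjecture.HodgeConjecture.R90.S9`)
* `smooth_tensOfPair_of_kitLaw` — `𝓕₀ p → Smooth (tensOfPair p)` from the «if» half of pin (iv).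
* **`transferPair_exists_of_kitLaws`** — `𝓕₀ p → ∃ f fH, (Smooth_cm p ∧ Transfer_cm p f) ∧ TransferH_cm p fH` (the `hex` binder at `𝓣 := 𝓕₀`, `Transfer₀`, `TransferH_cm`, pointwise;
  the weaker loose shapes `∃ f fH, Transfer_cm p f ∧ TransferH_cm p fH` are its projections).
* `transferPair_exists_of_kitLaws_normUnit` — the same on the class with NORMALISED units `μ_v(K_v)⁻¹ 𝟙_{K_v}` (★ (CMP-L2) `…_unit'` :303, ★ (d2) `_unit`) under the volume pin
  `hμK1 : μ_v(K_v) = 1` (B: `hvol`), which makes the two classes equal.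
B's terms: `hsm := fun f′ h => (‹pin (iv) at 𝔨› f′).2 h`, `htE := fun f′ h => let ⟨f, fH, hm⟩ := htE f′ h; ⟨f, fH, hm.1, hm.2⟩` (`Matches := Transfer ∧ TransferH`, KIT :374).

## References
[Rogawski1990] J. D. Rogawski, *Automorphic Representations of Unitary Groups in Three Variables*, Ann. of Math. Stud. 123 (1990): §14.2 p. 233 (14.2.1); §14.3 p. 234; §4.9
Prop. 4.9.1 p. 55; §14.6 p. 244.  [BorelJacquet1979] A. Borel, H. Jacquet, *Automorphic forms and automorphic representations*, PSPM 33.1 (1979), §4.1.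
-/

set_option autoImplicit false
-- the mandated namespace repeats `HodgeConjecture.HodgeConjecture`, as in every `Theorems/*.lean` of this sub-problem
set_option linter.dupNamespace false

noncomputable section

open NumberField IsDedekindDomain MeasureTheory
open scoped Matrix Classical
open Literature.NumberTheory Literature.NumberTheory.Automorphic Literature.NumberTheory.Automorphic.UnitaryGroup
open Literature.NumberTheory.Automorphic.UnitaryGroup.CotangentForms
open Literature.NumberTheory.Rogawski1990
open Summit.HodgeConjecture.HodgeConjecture.Cruxes.H413
open Summit.HodgeConjecture.HodgeConjecture.Cruxes.H413.F0P3InnerFormClassificationV6 (TestG TestH TestGp Places)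
open Summit.HodgeConjecture.HodgeConjecture.Cruxes.H413.F0P3SemilocalTestFunctionsOfRecord (tens₀_smooth)

namespace Summit.HodgeConjecture.HodgeConjecture.R90.S9

section TransferPairExists

variable (L : Type) [Field L] [NumberField L] [IsCMField L] (ι : L →+* ℂ) (H : Matrix (Fin 3) (Fin 3) L) (T : GL (Fin 3) ℂ)
  (hT : (T : Matrix (Fin 3) (Fin 3) ℂ)ᴴ * H.map ι * (T : Matrix (Fin 3) (Fin 3) ℂ) = Literature.Geometry.ComplexHyperbolic.BallModel.J)
  -- the kit's predicates on `C_c(G′(𝔸))` (at B: `𝔨.Smooth`, `𝔨.Transfer`, `𝔨.TransferH`)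
  (Smooth : TestGp L H → Prop) (Transfer : TestGp L H → TestG L → Prop) (TransferH : TestGp L H → TestH L → Prop)

/-- **A REALISED TEST PAIR IS SMOOTH IN THE KIT'S SENSE** — for `p = (φ, (f_v)_v)` on the test predicate `𝓕₀` (★ `ArchTestKc φ`, every `f_v` locally constant with compact support,
`f_v = 𝟙_{K_v}` off a finite set), `tensOfPair p = φ ⊗ ⊗_v f_v` is the evaluation of a TEST pure tensor (★ p862596 `tensOfPair` := `tens₀` of the canonical presentation;
★ `tens₀_smooth`), so the «if» half `hsm` of the kit's pin (iv) «`Smooth f′ ↔ ∃ T, T.IsTest ∧ ⇑f′ = T.eval`» makes it `Smooth`. [cite: Rogawski1990, §14.2 p. 233] [cite: BorelJacquet1979, §4.1] -/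
theorem smooth_tensOfPair_of_kitLaw
    (hsm : ∀ f' : TestGp L H, (∃ T' : PureTensor L 3 H, T'.IsTest ∧ ⇑f' = T'.eval) → Smooth f')
    (p : (UnitaryGroup.arch (↥(maximalRealSubfield L)) L (IsCMField.complexConj L) 3 H → ℂ) × (∀ v : Places L, (cmDatum L 3 H).Local v → ℂ))
    (hp : ArchTestKc L ι H T hT p.1 ∧ (∀ v : Places L, IsLocallyConstant (p.2 v) ∧ HasCompactSupport (p.2 v)) ∧
      {v : Places L | p.2 v ≠ (cmLocalIntegralLevel L 3 H v : Set ((cmDatum L 3 H).Local v)).indicator fun _ => (1 : ℂ)}.Finite) :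
    Smooth (tensOfPair L H ι T hT p) := by
  refine hsm _ ?_
  unfold tensOfPair
  rw [dif_pos hp]
  exact tens₀_smooth _ _ _

/-- **`hex` AT THE RECORD'S PINS — SMOOTH TRANSFER EXISTS ON `𝓕₀`** (the binder `hex : ∀ f′, 𝓣 f′ → ∃ f fH, Transfer f′ f ∧ TransferH f′ fH` of ★ (MN-cm)
`hmn_gammaSph_ofLevelPins` ∕ ★ (CMP-L2) `hcoeffMem_binder_gammaSph_recordSCD_ofLevels'` at `𝓣 := 𝓕₀`, `Transfer := fun p f => Smooth_cm p ∧ Transfer_cm p f` (SEAM 8),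
`TransferH := TransferH_cm` (TG-5), POINTWISE): for every test pair `p ∈ 𝓕₀` there are `f` on `G = U(Φ₃)(𝔸)` and `f^H` on `H(𝔸)` with `Smooth_cm p`, `Transfer_cm p f` (the guard
`IsKcBiInv (tensOfPair p)` by ★ p862626 `isKcBiInv_tensOfPair`, for EVERY `p`) and `TransferH_cm p f^H` — from the kit laws in generic shape: `hsm` (pin (iv), «if» half) and
`htE` (T1g `TransferExistence` with `Matches := Transfer ∧ TransferH` unfolded).  At B both are v5-telescope binders (`hpin`, `htE`): 0 `sorry`, no new residual.
[cite: Rogawski1990, §14.2 p. 233 (14.2.1); §14.3 p. 234; §4.9 Prop. 4.9.1 p. 55] [cite: BorelJacquet1979, §4.1] -/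
theorem transferPair_exists_of_kitLaws
    (hsm : ∀ f' : TestGp L H, (∃ T' : PureTensor L 3 H, T'.IsTest ∧ ⇑f' = T'.eval) → Smooth f')
    (htE : ∀ f' : TestGp L H, Smooth f' → ∃ (f : TestG L) (fH : TestH L), Transfer f' f ∧ TransferH f' fH)
    (p : (UnitaryGroup.arch (↥(maximalRealSubfield L)) L (IsCMField.complexConj L) 3 H → ℂ) × (∀ v : Places L, (cmDatum L 3 H).Local v → ℂ))
    (hp : ArchTestKc L ι H T hT p.1 ∧ (∀ v : Places L, IsLocallyConstant (p.2 v) ∧ HasCompactSupport (p.2 v)) ∧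
      {v : Places L | p.2 v ≠ (cmLocalIntegralLevel L 3 H v : Set ((cmDatum L 3 H).Local v)).indicator fun _ => (1 : ℂ)}.Finite) :
    ∃ (f : TestG L) (fH : TestH L),
      (Smooth_cm L ι H T hT Smooth p ∧ Transfer_cm L ι H T hT Transfer p f) ∧ TransferH_cm L ι H T hT Smooth TransferH p fH := by
  have hS : Smooth (tensOfPair L H ι T hT p) := smooth_tensOfPair_of_kitLaw L ι H T hT Smooth hsm p hp
  obtain ⟨f, fH, hf, hfH⟩ := htE _ hS
  exact ⟨f, fH, ⟨⟨hp, hS⟩, isKcBiInv_tensOfPair L H ι T hT p, hf⟩, ⟨hp, hS⟩, hfH⟩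

/-- **`hex` AT THE NORMALISED UNITS `e_v := μ_v(K_v)⁻¹ 𝟙_{K_v}`** (the test class of ★ (CMP-L2) `hcoeffMem_binder_gammaSph_recordSCD_ofLevels_unit'` :303 and of ★ (d2)'s `_unit` twin):
under the telescope's volume pin `hμK1 : μ_v(K_v) = 1` (B: `hvol`) the normalised unit IS `𝟙_{K_v}`, so the class is `𝓕₀` and `transferPair_exists_of_kitLaws` applies verbatim.
[cite: Rogawski1990, §14.2 p. 233 (14.2.1); §14.3 p. 234; §4.9 Prop. 4.9.1 p. 55] [cite: BorelJacquet1979, §4.1] -/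
theorem transferPair_exists_of_kitLaws_normUnit
    (μv : ∀ v : Places L, @Measure ((cmDatum L 3 H).Local v) (borel _))
    (hμK1 : ∀ v : Places L, μv v (cmLocalIntegralLevel L 3 H v : Set ((cmDatum L 3 H).Local v)) = 1)
    (hsm : ∀ f' : TestGp L H, (∃ T' : PureTensor L 3 H, T'.IsTest ∧ ⇑f' = T'.eval) → Smooth f')
    (htE : ∀ f' : TestGp L H, Smooth f' → ∃ (f : TestG L) (fH : TestH L), Transfer f' f ∧ TransferH f' fH)
    (p : (UnitaryGroup.arch (↥(maximalRealSubfield L)) L (IsCMField.complexConj L) 3 H → ℂ) × (∀ v : Places L, (cmDatum L 3 H).Local v → ℂ))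
    (hp : ArchTestKc L ι H T hT p.1 ∧ (∀ v : Places L, IsLocallyConstant (p.2 v) ∧ HasCompactSupport (p.2 v)) ∧
      {v : Places L | p.2 v ≠ (((μv v).real (cmLocalIntegralLevel L 3 H v : Set ((cmDatum L 3 H).Local v)) : ℂ))⁻¹ •
        (cmLocalIntegralLevel L 3 H v : Set ((cmDatum L 3 H).Local v)).indicator fun _ => (1 : ℂ)}.Finite) :
    ∃ (f : TestG L) (fH : TestH L),
      (Smooth_cm L ι H T hT Smooth p ∧ Transfer_cm L ι H T hT Transfer p f) ∧ TransferH_cm L ι H T hT Smooth TransferH p fH := by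
  -- under `μ_v(K_v) = 1` the normalised unit is the plain unit `𝟙_{K_v}`
  have hunit : ∀ v : Places L,
      (((μv v).real (cmLocalIntegralLevel L 3 H v : Set ((cmDatum L 3 H).Local v)) : ℂ))⁻¹ •
          (cmLocalIntegralLevel L 3 H v : Set ((cmDatum L 3 H).Local v)).indicator (fun _ => (1 : ℂ)) =
        (cmLocalIntegralLevel L 3 H v : Set ((cmDatum L 3 H).Local v)).indicator fun _ => (1 : ℂ) := fun v => by
    rw [measureReal_def, hμK1 v, ENNReal.toReal_one, Complex.ofReal_one, inv_one, one_smul]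
  have hset : {v : Places L | p.2 v ≠ (((μv v).real (cmLocalIntegralLevel L 3 H v : Set ((cmDatum L 3 H).Local v)) : ℂ))⁻¹ •
        (cmLocalIntegralLevel L 3 H v : Set ((cmDatum L 3 H).Local v)).indicator fun _ => (1 : ℂ)} =
      {v : Places L | p.2 v ≠ (cmLocalIntegralLevel L 3 H v : Set ((cmDatum L 3 H).Local v)).indicator fun _ => (1 : ℂ)} := by
    ext v
    rw [Set.mem_setOf_eq, Set.mem_setOf_eq, hunit v]
  exact transferPair_exists_of_kitLaws L ι H T hT Smooth Transfer TransferH hsm htE p ⟨hp.1, hp.2.1, hset ▸ hp.2.2⟩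

end TransferPairExists

end Summit.HodgeConjecture.HodgeConjecture.R90.S9

end
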